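import Summits.QuantumFields.QCD.Theses.NestedDissectionSea
import Literature.MathematicalPhysics.QuantumFieldTheory.QCDPhaseQuenched

/-!
# Crux `NegativeCellsDilute` (stmt-QuantumFields-13900), line `mass-wegner-cell-index` —
# stub `stub_reverseWegnerCount` (REVERSE WEGNER COUNTING)

For every torus side `N`, coupling `β`, flavour number `Nf`, valence masses `mq`, corner-`0`
box `s` and tolerance `η > 0`: ANY event `E` on gauge fields which forces, for some flavour `f`,
a crossing-type sojourn — a mass `μ₀ ∈ [mq f, −edge(s)]`, `edge(s) = Σ_i (1 − cos(π/s_i))`,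
with an `η`-near kernel vector of the parent Dirichlet cell or of one of its sixteen children at
every bare mass `μ'` within `η` of `μ₀` — has phase-quenched probability at most the strip
statistic `η⁻¹ Σ_f ∫_{μ' ∈ [mq f, η − edge(s)]} P(near_η(·, μ')) dμ'`.

Proof. An abstract counting lemma (`reverseWegner_abstract`) for a finite measure `μ`, a
nonnegative integrable weight `w`, a jointly measurable event `near ⊆ Ω × ℝ` and an event `E`
with the sojourn property: pointwise
`1_E(U) w(U) ≤ η⁻¹ Σ_f Leb{μ' ∈ I_f | near(U, μ')} w(U)` (the half-sojourn `[μ₀, μ₀ + η)`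
lies in the strip `I_f = [a_f, b_f]`), integrate in `U`, swap the integrals (Tonelli,
`MeasureTheory.lintegral_lintegral_swap`), normalise by `Z = ∫ w dμ` (`Z = 0` and a
non-integrable `1_E w` give the junk value `0` on the left). The near-kernel event is OPEN in
`(U, μ')` — a union over the test vectors `v` of strict sub-level sets of continuous functions
(the Wilson–Dirac matrix is jointly continuous in the gauge field and the mass) — hence Borel.
-/

noncomputable section

namespace Summit.QuantumFields.QCD.Cruxes.NegativeCellsDilute.MassWegnerCellIndex

open scoped BigOperators ENNReal Classical
open MeasureTheory Filter
open Literature.MathematicalPhysics.QuantumLattice Literature.MathematicalPhysics.QuantumFieldTheory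
  Literature.Probability.LatticeModels

/-! ## The abstract counting lemma -/

section Abstract

variable {Ω : Type*} [MeasurableSpace Ω] {ι : Type*} [Fintype ι]

/-- Sojourn lower bound: if `near μ'` holds whenever `|μ' − μ₀| < η` and
`[μ₀, μ₀ + η) ⊆ [a, b]`, then `Leb{μ' ∈ [a, b] | near μ'} ≥ η`. -/
private theorem reverseWegner_sojourn_volume {near : ℝ → Prop} {_dn : DecidablePred near}
    {a b μ₀ η : ℝ} (ha : a ≤ μ₀) (hb : μ₀ + η ≤ b)
    (hnear : ∀ μ', |μ' - μ₀| < η → near μ') :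
    ENNReal.ofReal η ≤ ∫⁻ μ' in Set.Icc a b, (if near μ' then (1 : ℝ≥0∞) else 0) := by
  have hsub : Set.Ico μ₀ (μ₀ + η) ⊆ Set.Icc a b := fun x hx =>
    ⟨le_trans ha hx.1, le_trans hx.2.le hb⟩
  have hle : ∀ μ', (Set.Ico μ₀ (μ₀ + η)).indicator (1 : ℝ → ℝ≥0∞) μ' ≤
      (if near μ' then (1 : ℝ≥0∞) else 0) := by
    intro μ'
    by_cases hμ' : μ' ∈ Set.Ico μ₀ (μ₀ + η)
    · have hn : near μ' :=
        hnear μ' (abs_sub_lt_iff.mpr ⟨by linarith [hμ'.2], by linarith [hμ'.1, hμ'.2]⟩)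
      rw [Set.indicator_of_mem hμ', if_pos hn, Pi.one_apply]
    · rw [Set.indicator_of_notMem hμ']
      exact zero_le
  calc ENNReal.ofReal η = volume (Set.Ico μ₀ (μ₀ + η)) := by
        rw [Real.volume_Ico, add_sub_cancel_left]
    _ = ∫⁻ μ' in Set.Icc a b, (Set.Ico μ₀ (μ₀ + η)).indicator 1 μ' := by
        rw [lintegral_indicator_one measurableSet_Ico, Measure.restrict_apply measurableSet_Ico,
          Set.inter_eq_left.mpr hsub]
    _ ≤ ∫⁻ μ' in Set.Icc a b, (if near μ' then (1 : ℝ≥0∞) else 0) :=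
        lintegral_mono hle

omit [MeasurableSpace Ω] in
/-- Pointwise reverse-Wegner bound: under the sojourn property of `E`,
`1_E(U) w(U) ≤ η⁻¹ Σ_f ∫⁻_{μ' ∈ [a_f, b_f]} 1_{near(U, μ')} w(U)` (in `ℝ≥0∞`). -/
private theorem reverseWegner_pointwise (w : Ω → ℝ) (near : Ω → ℝ → Prop)
    {_dn : ∀ U μ', Decidable (near U μ')} (E : Ω → Prop) {_dE : DecidablePred E} {η : ℝ}
    (hη : 0 < η) (a b : ι → ℝ)
    (hE : ∀ U, E U → ∃ f, ∃ μ₀ : ℝ, a f ≤ μ₀ ∧ μ₀ + η ≤ b f ∧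
      ∀ μ', |μ' - μ₀| < η → near U μ') (U : Ω) :
    ENNReal.ofReal ((if E U then (1 : ℝ) else 0) * w U) ≤
      ENNReal.ofReal η⁻¹ * ∑ f, ∫⁻ μ' in Set.Icc (a f) (b f),
        (if near U μ' then (1 : ℝ≥0∞) else 0) * ENNReal.ofReal (w U) := by
  by_cases hU : E U
  swap
  · rw [if_neg hU, zero_mul, ENNReal.ofReal_zero]
    exact zero_le
  obtain ⟨f₀, μ₀, ha, hb, hnear⟩ := hE U hU
  rw [if_pos hU, one_mul]
  have hsum : (∫⁻ μ' in Set.Icc (a f₀) (b f₀),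
      (if near U μ' then (1 : ℝ≥0∞) else 0) * ENNReal.ofReal (w U)) ≤
      ∑ f, ∫⁻ μ' in Set.Icc (a f) (b f),
        (if near U μ' then (1 : ℝ≥0∞) else 0) * ENNReal.ofReal (w U) :=
    Finset.single_le_sum (f := fun f => ∫⁻ μ' in Set.Icc (a f) (b f),
      (if near U μ' then (1 : ℝ≥0∞) else 0) * ENNReal.ofReal (w U)) (fun _ _ => zero_le)
      (Finset.mem_univ f₀)
  calc ENNReal.ofReal (w U)
      = ENNReal.ofReal η⁻¹ * (ENNReal.ofReal η * ENNReal.ofReal (w U)) := by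
        rw [← mul_assoc, ← ENNReal.ofReal_mul (inv_nonneg.mpr hη.le),
          inv_mul_cancel₀ hη.ne', ENNReal.ofReal_one, one_mul]
    _ ≤ ENNReal.ofReal η⁻¹ * ∑ f, ∫⁻ μ' in Set.Icc (a f) (b f),
          (if near U μ' then (1 : ℝ≥0∞) else 0) * ENNReal.ofReal (w U) := by
        gcongr
        calc ENNReal.ofReal η * ENNReal.ofReal (w U)
            ≤ (∫⁻ μ' in Set.Icc (a f₀) (b f₀), (if near U μ' then (1 : ℝ≥0∞) else 0)) *
                ENNReal.ofReal (w U) := by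
              gcongr
              exact reverseWegner_sojourn_volume ha hb hnear
          _ = ∫⁻ μ' in Set.Icc (a f₀) (b f₀),
                (if near U μ' then (1 : ℝ≥0∞) else 0) * ENNReal.ofReal (w U) :=
              (lintegral_mul_const' _ _ ENNReal.ofReal_ne_top).symm
          _ ≤ _ := hsum

/-- **Reverse Wegner counting, abstract form.** For a finite measure `μ`, a nonnegative
measurable integrable weight `w`, a jointly measurable event `near ⊆ Ω × ℝ`, strips `[a_f, b_f]`
and an event `E` such that every `U ∈ E` has a flavour `f` and a mass `μ₀` with
`[μ₀, μ₀ + η) ⊆ [a_f, b_f]` and `near(U, μ')` for all `|μ' − μ₀| < η`: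
`(∫ 1_E w dμ)/Z ≤ η⁻¹ Σ_f ∫_{[a_f, b_f]} (∫ 1_{near(·, μ')} w dμ)/Z dμ'`, `Z = ∫ w dμ`
(real division, `x/0 = 0`; the left integral is the junk `0` if `1_E w` is not integrable). -/
private theorem reverseWegner_abstract (μ : Measure Ω) [IsFiniteMeasure μ] (w : Ω → ℝ)
    (near : Ω → ℝ → Prop) {_dn : ∀ U μ', Decidable (near U μ')} (E : Ω → Prop)
    {_dE : DecidablePred E} {η : ℝ} (hη : 0 < η) (a b : ι → ℝ)
    (hw0 : ∀ U, 0 ≤ w U) (hwm : Measurable w) (hwi : Integrable w μ)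
    (hA : MeasurableSet {q : Ω × ℝ | near q.1 q.2})
    (hE : ∀ U, E U → ∃ f, ∃ μ₀ : ℝ, a f ≤ μ₀ ∧ μ₀ + η ≤ b f ∧
      ∀ μ', |μ' - μ₀| < η → near U μ') :
    (∫ U, (if E U then (1 : ℝ) else 0) * w U ∂μ) / (∫ U, w U ∂μ) ≤
      η⁻¹ * ∑ f, (∫⁻ μ' in Set.Icc (a f) (b f), ENNReal.ofReal
        ((∫ U, (if near U μ' then (1 : ℝ) else 0) * w U ∂μ) / (∫ U, w U ∂μ))).toReal := by
  -- elementary pointwise facts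
  have hnn : ∀ (U : Ω) (μ' : ℝ), 0 ≤ (if near U μ' then (1 : ℝ) else 0) * w U :=
    fun U μ' => mul_nonneg (by split_ifs <;> norm_num) (hw0 U)
  have hnnE : ∀ U : Ω, 0 ≤ (if E U then (1 : ℝ) else 0) * w U :=
    fun U => mul_nonneg (by split_ifs <;> norm_num) (hw0 U)
  have hle1 : ∀ (U : Ω) (μ' : ℝ), (if near U μ' then (1 : ℝ) else 0) * w U ≤ w U :=
    fun U μ' => by split_ifs <;> simp [hw0 U]
  -- measurability of the sections and integrability of the numerators
  have hsec : ∀ μ' : ℝ, MeasurableSet {U : Ω | near U μ'} := fun μ' =>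
    measurable_prodMk_right hA
  have hint : ∀ μ' : ℝ, Integrable (fun U => (if near U μ' then (1 : ℝ) else 0) * w U) μ :=
    fun μ' => hwi.mono'
      ((Measurable.ite (hsec μ') measurable_const measurable_const).mul
        hwm).aestronglyMeasurable
      (Eventually.of_forall fun U => by
        rw [Real.norm_eq_abs, abs_of_nonneg (hnn U μ')]
        exact hle1 U μ')
  -- the measurable integrand on the product
  have hg : Measurable fun q : Ω × ℝ => (if near q.1 q.2 then (1 : ℝ≥0∞) else 0) :=
    Measurable.ite hA measurable_const measurable_const
  have hF : Measurable fun q : Ω × ℝ =>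
      (if near q.1 q.2 then (1 : ℝ≥0∞) else 0) * ENNReal.ofReal (w q.1) :=
    hg.mul (hwm.comp measurable_fst).ennreal_ofReal
  -- the un-normalised inequality in `ℝ≥0∞`
  have key : ENNReal.ofReal (∫ U, (if E U then (1 : ℝ) else 0) * w U ∂μ) ≤
      ENNReal.ofReal η⁻¹ * ∑ f, ∫⁻ μ' in Set.Icc (a f) (b f),
        ENNReal.ofReal (∫ U, (if near U μ' then (1 : ℝ) else 0) * w U ∂μ) := by
    by_cases hEi : Integrable (fun U => (if E U then (1 : ℝ) else 0) * w U) μ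
    swap
    · rw [integral_undef hEi, ENNReal.ofReal_zero]
      exact zero_le
    rw [ofReal_integral_eq_lintegral_ofReal hEi (Eventually.of_forall fun U => hnnE U)]
    calc ∫⁻ U, ENNReal.ofReal ((if E U then (1 : ℝ) else 0) * w U) ∂μ
        ≤ ∫⁻ U, (ENNReal.ofReal η⁻¹ * ∑ f, ∫⁻ μ' in Set.Icc (a f) (b f),
            (if near U μ' then (1 : ℝ≥0∞) else 0) * ENNReal.ofReal (w U)) ∂μ :=
          lintegral_mono fun U => reverseWegner_pointwise w near E hη a b hE U
      _ = ENNReal.ofReal η⁻¹ * ∑ f, ∫⁻ U, (∫⁻ μ' in Set.Icc (a f) (b f),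
            (if near U μ' then (1 : ℝ≥0∞) else 0) * ENNReal.ofReal (w U)) ∂μ := by
          rw [lintegral_const_mul _
              (Finset.measurable_sum _ fun f _ => hF.lintegral_prod_right'),
            lintegral_finsetSum _ fun f _ => hF.lintegral_prod_right']
      _ = ENNReal.ofReal η⁻¹ * ∑ f, ∫⁻ μ' in Set.Icc (a f) (b f), (∫⁻ U,
            (if near U μ' then (1 : ℝ≥0∞) else 0) * ENNReal.ofReal (w U) ∂μ) := by
          congr 1
          refine Finset.sum_congr rfl fun f _ => ?_
          rw [lintegral_lintegral_swap]
          exact hF.aemeasurable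
      _ = ENNReal.ofReal η⁻¹ * ∑ f, ∫⁻ μ' in Set.Icc (a f) (b f),
            ENNReal.ofReal (∫ U, (if near U μ' then (1 : ℝ) else 0) * w U ∂μ) := by
          congr 1
          refine Finset.sum_congr rfl fun f _ => ?_
          refine lintegral_congr fun μ' => ?_
          rw [ofReal_integral_eq_lintegral_ofReal (hint μ')
            (Eventually.of_forall fun U => hnn U μ')]
          refine lintegral_congr fun U => ?_
          split_ifs <;> simp
  -- all strip integrals are finite
  have hXfin : ∀ f, ∫⁻ μ' in Set.Icc (a f) (b f),
      ENNReal.ofReal (∫ U, (if near U μ' then (1 : ℝ) else 0) * w U ∂μ) ≠ ∞ := by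
    intro f
    refine ne_top_of_le_ne_top ?_ (lintegral_mono fun μ' =>
      ENNReal.ofReal_le_ofReal (integral_mono (hint μ') hwi fun U => hle1 U μ'))
    rw [setLIntegral_const]
    exact ENNReal.mul_ne_top ENNReal.ofReal_ne_top measure_Icc_lt_top.ne
  have hfin : ENNReal.ofReal η⁻¹ * ∑ f, ∫⁻ μ' in Set.Icc (a f) (b f),
      ENNReal.ofReal (∫ U, (if near U μ' then (1 : ℝ) else 0) * w U ∂μ) ≠ ∞ :=
    ENNReal.mul_ne_top ENNReal.ofReal_ne_top (ENNReal.sum_ne_top.mpr fun f _ => hXfin f)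
  -- back to real numbers
  have hreal : ∫ U, (if E U then (1 : ℝ) else 0) * w U ∂μ ≤
      η⁻¹ * ∑ f, (∫⁻ μ' in Set.Icc (a f) (b f),
        ENNReal.ofReal (∫ U, (if near U μ' then (1 : ℝ) else 0) * w U ∂μ)).toReal := by
    have h := ENNReal.toReal_mono hfin key
    rwa [ENNReal.toReal_ofReal (integral_nonneg hnnE), ENNReal.toReal_mul,
      ENNReal.toReal_ofReal (inv_nonneg.mpr hη.le),
      ENNReal.toReal_sum (fun f _ => hXfin f)] at h
  -- normalisation
  rcases (integral_nonneg hw0 : (0 : ℝ) ≤ ∫ U, w U ∂μ).eq_or_lt with hZ | hZ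
  · rw [← hZ, div_zero]
    exact mul_nonneg (inv_nonneg.mpr hη.le)
      (Finset.sum_nonneg fun _ _ => ENNReal.toReal_nonneg)
  have hdiv : ∀ f, ∫⁻ μ' in Set.Icc (a f) (b f), ENNReal.ofReal
      ((∫ U, (if near U μ' then (1 : ℝ) else 0) * w U ∂μ) / (∫ U, w U ∂μ)) =
      (∫⁻ μ' in Set.Icc (a f) (b f),
        ENNReal.ofReal (∫ U, (if near U μ' then (1 : ℝ) else 0) * w U ∂μ)) /
        ENNReal.ofReal (∫ U, w U ∂μ) := by
    intro f
    simp_rw [ENNReal.ofReal_div_of_pos hZ, ENNReal.div_eq_inv_mul]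
    exact lintegral_const_mul' _ _ (ENNReal.inv_ne_top.mpr (ENNReal.ofReal_pos.mpr hZ).ne')
  simp_rw [hdiv, ENNReal.toReal_div, ENNReal.toReal_ofReal hZ.le, ← Finset.sum_div,
    ← mul_div_assoc]
  exact div_le_div_of_nonneg_right hreal hZ.le

end Abstract

/-! ## The Wilson instance (`SU3 = Matrix.specialUnitaryGroup (Fin 3) ℂ`, tree abbreviation):
## continuity and measurability of the near-kernel event -/

section Wilson

variable {N : ℕ} [NeZero N]

omit [NeZero N] in
/-- `(U, m) ↦ D_W(U, m, 1)` is jointly continuous: every entry is the mass term `(m + 4) δ`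
plus a finite sum of entries of `ρ(U_e)`, `ρ(U_e⁻¹)` times fixed spin matrices
(cf. the tree's `continuous_wilsonDirac`, continuity in `U` at fixed mass). -/
private theorem reverseWegner_continuous_wilsonDirac₂ :
    Continuous fun q : GaugeConfig 4 N SU3 × ℝ =>
      wilsonDirac (fundamentalRep (Fin 3)) q.1 q.2 1 := by
  have hρ := continuous_fundamentalRep (Fin 3)
  have hlink : ∀ e, Continuous fun q : GaugeConfig 4 N SU3 × ℝ => q.1 e := fun e =>
    (continuous_apply e).comp continuous_fst
  refine continuous_pi fun p => continuous_pi fun p' => ?_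
  simp only [wilsonDirac, Matrix.of_apply]
  refine Continuous.sub ?_ (continuous_const.mul (continuous_finsetSum _ fun μ _ => ?_))
  · split_ifs
    · exact Complex.continuous_ofReal.comp (continuous_snd.add continuous_const)
    · exact continuous_const
  refine Continuous.add ?_ ?_
  · split_ifs
    · exact continuous_const.mul ((hρ.comp (hlink _)).matrix_elem _ _)
    · exact continuous_const
  · split_ifs
    · exact continuous_const.mul ((hρ.comp (hlink _).inv).matrix_elem _ _)
    · exact continuous_const

/-- For a fixed test vector `v`, `(U, μ') ↦ Σ_p ‖(wilsonCell U μ' x s) v p‖²` is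
continuous. -/
private theorem reverseWegner_continuous_form (x : TorusSite 4 N) (s : Fin 4 → ℕ)
    (v : {p // wilsonBox x s p} → ℂ) :
    Continuous fun q : GaugeConfig 4 N SU3 × ℝ =>
      ∑ p, ‖(wilsonCell q.1 q.2 x s).mulVec v p‖ ^ 2 := by
  have hc : Continuous fun q : GaugeConfig 4 N SU3 × ℝ => wilsonCell q.1 q.2 x s :=
    reverseWegner_continuous_wilsonDirac₂.matrix_submatrix _ _
  exact continuous_finsetSum _ fun p _ =>
    ((continuous_apply p).comp (hc.matrix_mulVec continuous_const)).norm.pow 2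

/-- The near-kernel event `near_η(U, μ')` (parent box `(0, s)` or one of its sixteen children
has a nonzero `v` with `Σ_p ‖(wilsonCell U μ' · ·) v p‖² < η² Σ_p ‖v p‖²`) is a Borel subset
of `GaugeConfig × ℝ`: it is open. -/
private theorem reverseWegner_measurableSet_near (s : Fin 4 → ℕ) (η : ℝ) :
    MeasurableSet {q : GaugeConfig 4 N SU3 × ℝ |
      (∃ v : {p // wilsonBox (0 : TorusSite 4 N) s p} → ℂ, v ≠ 0 ∧
          ∑ p, ‖(wilsonCell q.1 q.2 0 s).mulVec v p‖ ^ 2 < η ^ 2 * ∑ p, ‖v p‖ ^ 2) ∨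
        ∃ c : Fin 4 → Bool,
          ∃ v : {p // wilsonBox (halfCorner s c : TorusSite 4 N) (halfSides s c) p} → ℂ,
            v ≠ 0 ∧
              ∑ p, ‖(wilsonCell q.1 q.2 (halfCorner s c) (halfSides s c)).mulVec v p‖ ^ 2 <
                η ^ 2 * ∑ p, ‖v p‖ ^ 2} := by
  refine IsOpen.measurableSet ?_
  simp only [Set.setOf_or, Set.setOf_exists, Set.setOf_and]
  refine (isOpen_iUnion fun v => isOpen_const.inter
      (isOpen_lt (reverseWegner_continuous_form 0 s v) continuous_const)).union
    (isOpen_iUnion fun c => isOpen_iUnion fun v => isOpen_const.inter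
      (isOpen_lt (reverseWegner_continuous_form _ _ v) continuous_const))

/-- The phase-quenched weight `U ↦ ∏_f |det D_W(U, m_f, 1)|` is measurable and integrable
against every finite measure (tree: `measurable_norm_det_diracMatrix`,
`integrable_norm_det_diracMatrix`, `norm_det_diracMatrix`). -/
private theorem reverseWegner_weight {Nf : ℕ} (mq : Fin Nf → ℝ) :
    (Measurable fun U : GaugeConfig 4 N SU3 =>
        ∏ f, ‖fermionDet (wilsonDirac (fundamentalRep (Fin 3)) U (mq f) 1)‖) ∧
      ∀ (μ : Measure (GaugeConfig 4 N SU3)) [IsFiniteMeasure μ],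
        Integrable (fun U =>
          ∏ f, ‖fermionDet (wilsonDirac (fundamentalRep (Fin 3)) U (mq f) 1)‖) μ := by
  refine ⟨?_, fun μ _ => ?_⟩
  · have h := measurable_norm_det_diracMatrix (S := N) mq
    simp_rw [norm_det_diracMatrix] at h
    exact h
  · have h := integrable_norm_det_diracMatrix (S := N) mq μ
    simp_rw [norm_det_diracMatrix] at h
    exact h

end Wilson

/-! ## The stub -/

/-- **Stub 2 — `reverseWegnerCount` (REVERSE WEGNER COUNTING).** For every torus side `N`,
coupling `β`, flavour number `Nf`, valence masses `mq`, corner-`0` box `s` and tolerance `η > 0`: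
ANY event `E` on gauge fields which forces, for some flavour `f`, a crossing-type sojourn — a mass
`μ₀ ∈ [mq f, −edge(s)]` with `near_η(U, μ′)` at every `μ′` within `η` of `μ₀` — has
phase-quenched probability at most the strip statistic
`η⁻¹ Σ_f ∫_{μ′ ∈ [mq f, η − edge(s)]} P(near_η(·, μ′)) dμ′`.
Proof: `reverseWegner_abstract` for the Wilson probability measure, the weight `∏_f |det D_W|`
and the (open, hence measurable) near-kernel event; the half-sojourn `[μ₀, μ₀ + η)` lies in the
strip because `mq f ≤ μ₀ ≤ −edge(s)`. -/
theorem stub_reverseWegnerCount :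
    ∀ (N : ℕ) [NeZero N] (β : ℝ) (Nf : ℕ) (mq : Fin Nf → ℝ) (s : Fin 4 → ℕ) (η : ℝ), 0 < η →
      ∀ E : GaugeConfig 4 N (Matrix.specialUnitaryGroup (Fin 3) ℂ) → Prop,
        (∀ U, E U → ∃ f : Fin Nf, ∃ μ₀ : ℝ, mq f ≤ μ₀ ∧ μ₀ ≤ -∑ i, (1 - Real.cos (Real.pi / s i)) ∧
            ∀ μ' : ℝ, |μ' - μ₀| < η →
              ((∃ v : {p // wilsonBox (0 : TorusSite 4 N) s p} → ℂ, v ≠ 0 ∧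
                  ∑ p, ‖(wilsonCell U μ' 0 s).mulVec v p‖ ^ 2 < η ^ 2 * ∑ p, ‖v p‖ ^ 2) ∨
                ∃ c : Fin 4 → Bool, ∃ v : {p // wilsonBox (halfCorner s c : TorusSite 4 N) (halfSides s c) p} → ℂ,
                  v ≠ 0 ∧ ∑ p, ‖(wilsonCell U μ' (halfCorner s c) (halfSides s c)).mulVec v p‖ ^ 2 <
                    η ^ 2 * ∑ p, ‖v p‖ ^ 2)) →
        (∫ U : GaugeConfig 4 N (Matrix.specialUnitaryGroup (Fin 3) ℂ), (if E U then (1 : ℝ) else 0) *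
              ∏ f, ‖fermionDet (wilsonDirac (fundamentalRep (Fin 3)) U (mq f) 1)‖ ∂(wilsonMeasure (fundamentalRep (Fin 3)) β)) /
          (∫ U : GaugeConfig 4 N (Matrix.specialUnitaryGroup (Fin 3) ℂ),
              ∏ f, ‖fermionDet (wilsonDirac (fundamentalRep (Fin 3)) U (mq f) 1)‖ ∂(wilsonMeasure (fundamentalRep (Fin 3)) β)) ≤
          η⁻¹ * ∑ f, (∫⁻ μ' in Set.Icc (mq f) (η - ∑ i, (1 - Real.cos (Real.pi / s i))),
            ENNReal.ofReal
              ((∫ U : GaugeConfig 4 N (Matrix.specialUnitaryGroup (Fin 3) ℂ), (if ((∃ v : {p // wilsonBox (0 : TorusSite 4 N) s p} → ℂ, v ≠ 0 ∧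
                    ∑ p, ‖(wilsonCell U μ' 0 s).mulVec v p‖ ^ 2 < η ^ 2 * ∑ p, ‖v p‖ ^ 2) ∨
                  ∃ c : Fin 4 → Bool, ∃ v : {p // wilsonBox (halfCorner s c : TorusSite 4 N) (halfSides s c) p} → ℂ,
                    v ≠ 0 ∧ ∑ p, ‖(wilsonCell U μ' (halfCorner s c) (halfSides s c)).mulVec v p‖ ^ 2 <
                      η ^ 2 * ∑ p, ‖v p‖ ^ 2) then (1 : ℝ) else 0) *
                    ∏ f, ‖fermionDet (wilsonDirac (fundamentalRep (Fin 3)) U (mq f) 1)‖ ∂(wilsonMeasure (fundamentalRep (Fin 3)) β)) /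
                (∫ U : GaugeConfig 4 N (Matrix.specialUnitaryGroup (Fin 3) ℂ),
                    ∏ f, ‖fermionDet (wilsonDirac (fundamentalRep (Fin 3)) U (mq f) 1)‖ ∂(wilsonMeasure (fundamentalRep (Fin 3)) β)))).toReal := by
  intro N _ β Nf mq s η hη E hE
  obtain ⟨hwm, hwi⟩ := reverseWegner_weight (N := N) mq
  refine reverseWegner_abstract (wilsonMeasure (d := 4) (L := N) (fundamentalRep (Fin 3)) β)
    (fun U => ∏ f, ‖fermionDet (wilsonDirac (fundamentalRep (Fin 3)) U (mq f) 1)‖) _ E hη _ _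
    (fun U => Finset.prod_nonneg fun f _ => norm_nonneg _) hwm (hwi _) ?_ ?_
  · exact reverseWegner_measurableSet_near s η
  · intro U hU
    obtain ⟨f, μ₀, h1, h2, h3⟩ := hE U hU
    exact ⟨f, μ₀, h1, by linarith, h3⟩

end Summit.QuantumFields.QCD.Cruxes.NegativeCellsDilute.MassWegnerCellIndex

end
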